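import Mathlib.Tactic
import HarnessLib

/-!
# Kozma–Nitzan's Question 8 at three relays — the merge-induction skeleton for the uniform form (gen 31)

Support file (`--supports stmt-CriticalPhenomena-4575`, closed crux; independent mathematics on Kozma–Nitzan's Question 8,
arXiv:2401.12397 §5.5 p. 36), prover `prim-ineq-gen-6` (gen 31).  No definitions, no named facts, no sorries; standard axioms.
Memo `run/shared/lean/prim/prim-ineq-gen-6/FINDING-G31.md` §4.

The generalised uniform form `UNIF-G` (FINDING-G31 §2) at a first crossing with `k` depths reads
`w·x₀(B) + Σ_{1 ≤ l < k} X(B,l) ≤ 0` for every depth-0 weight `w ∈ [0, W]` (`W = 1 − λ`).  Merging the first two vertices of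
the tail (`b₁b₂ ↦` one vertex, edge `e₂` contracted) produces a block `merge B` with `k−1` depths and the EXACT identity
`X(B,l) = s₂(B)·X(merge B, l−1) − EXC(B,l)` with `EXC ≥ 0` for `l ≥ 2` (FINDING-G31 §4, checked exactly).  The abstract theorem
below records that `UNIF-G` for every block then follows, by induction on `k`, from the base case (`k = 1`) and the ONE-STEP
inequality `(M′)`: `w·x₀(B) + X(B,1) ≤ s₂(B)·W·max(x₀(merge B),0) + Σ_{2 ≤ l < k} EXC(B,l)`, in which the induction hypothesis is
used with the optimal depth-0 weight (`W` if `x₀(merge B) > 0`, else `0`).  Depths are indexed from `0`: the sum over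
`1 ≤ l < k` is written `Σ_{i < k−1} X(B,i+1)`.
[cite: KozmaNitzan2024, Question 8 (§5.5 p. 36)]
-/

namespace Summit.CriticalPhenomena.PercolationContinuityZ3.Theorems

namespace PocketCert

open Finset

/-- **Merge induction for the uniform form.**  Abstract bookkeeping: `cross B` is the number of depths (the first-crossing
index), `merge` lowers it by one, `X` are the per-depth terms, `x₀` the per-unit depth-0 term, `s₂ ≥ 0` the weight of the
contracted edge, `EXC ≥ 0` is not even needed as a hypothesis — only the identity `hid`, the base case `hbase` and the step `hstep`.
Conclusion: `w·x₀(B) + Σ_{i < cross B − 1} X(B, i+1) ≤ 0` for all `w ∈ [0, W]`.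
[cite: KozmaNitzan2024, Question 8 (§5.5 p. 36)] -/
theorem merge_induction {Blk : Type*} (merge : Blk → Blk) (cross : Blk → ℕ) (s₂ x₀ : Blk → ℝ)
    (X EXC : Blk → ℕ → ℝ) (W : ℝ)
    (hs : ∀ B, 0 ≤ s₂ B)
    (hcross : ∀ B, 2 ≤ cross B → cross (merge B) + 1 = cross B)
    (hbase : ∀ B, cross B = 1 → x₀ B ≤ 0)
    (hid : ∀ B i, 2 ≤ i + 2 → i + 2 < cross B + 1 → 2 ≤ cross B →
        X B (i + 2) = s₂ B * X (merge B) (i + 1) - EXC B (i + 2))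
    (hstep : ∀ B w, 2 ≤ cross B → 0 ≤ w → w ≤ W →
        w * x₀ B + X B 1 - s₂ B * W * max (x₀ (merge B)) 0
          - ∑ i ∈ range (cross B - 2), EXC B (i + 2) ≤ 0) :
    ∀ n B w, cross B = n + 1 → 0 ≤ w → w ≤ W →
        w * x₀ B + ∑ i ∈ range n, X B (i + 1) ≤ 0 := by
  intro n
  induction n with
  | zero =>
    intro B w hc hw0 _
    simp only [Finset.range_zero, Finset.sum_empty, add_zero]
    have hx := hbase B (by simpa using hc)
    nlinarith
  | succ m ih =>
    intro B w hc hw0 hwW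
    have hcB : 2 ≤ cross B := by omega
    have hcm : cross (merge B) = m + 1 := by
      have := hcross B hcB; omega
    -- split the sum: depth 1 + depths 2..m+1
    rw [Finset.sum_range_succ']
    -- rewrite the deep terms through the identity
    have hdeep : ∑ i ∈ range m, X B (i + 1 + 1)
        = s₂ B * ∑ i ∈ range m, X (merge B) (i + 1) - ∑ i ∈ range m, EXC B (i + 2) := by
      rw [Finset.mul_sum, ← Finset.sum_sub_distrib]
      apply Finset.sum_congr rfl
      intro i hi
      have hi' : i < m := Finset.mem_range.mp hi
      have h := hid B i (by omega) (by omega) hcB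
      simpa [add_assoc] using h
    rw [hdeep]
    -- induction hypothesis for the merged block with the optimal weight
    have hW : 0 ≤ W := le_trans hw0 hwW
    have hIH : s₂ B * ∑ i ∈ range m, X (merge B) (i + 1) ≤ - (s₂ B * W * max (x₀ (merge B)) 0) := by
      rcases le_or_gt (x₀ (merge B)) 0 with hneg | hpos
      · have h0 := ih (merge B) 0 hcm le_rfl hW
        have hmax : max (x₀ (merge B)) 0 = 0 := max_eq_right hneg
        rw [hmax]
        have : ∑ i ∈ range m, X (merge B) (i + 1) ≤ 0 := by simpa using h0
        have := mul_le_mul_of_nonneg_left this (hs B)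
        simpa using this
      · have h1 := ih (merge B) W hcm hW le_rfl
        have hmax : max (x₀ (merge B)) 0 = x₀ (merge B) := max_eq_left hpos.le
        rw [hmax]
        have : ∑ i ∈ range m, X (merge B) (i + 1) ≤ -(W * x₀ (merge B)) := by linarith
        have := mul_le_mul_of_nonneg_left this (hs B)
        nlinarith [this]
    have hst := hstep B w hcB hw0 hwW
    have hm : cross B - 2 = m := by omega
    rw [hm] at hst
    linarith

end PocketCert

end Summit.CriticalPhenomena.PercolationContinuityZ3.Theorems
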